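import Literature.MathematicalPhysics.QuantumFieldTheory.Dimock2011to13.LargeFieldRegionVolume

/-!
# The parameter regime of the kernel end chain `RegionVolume.stability_of_regions` is NON-EMPTY: every numeric side
condition holds for `λ` sufficiently small, the other parameters fixed — a non-vacuity certificate for the template's
kernel version of [Dimock2013BalabanIII] §3 ((stingray) ∧ (under) ∧ (randall) ⇒ Corollary 1)

**Citation header (template of the Balaban lattice Yang–Mills cell; no manuscript under audit is touched).**
J. Dimock, *The renormalization group according to Balaban. III. Convergence*, Ann. Henri Poincaré **15** (2014)
2133–2175 (= arXiv:1304.0705v1) [Dimock2013BalabanIII]: Theorem 1 (TeX L265–270: *"Let 0 < λ < e^{−1} … Let L be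
sufficiently large, let M be sufficiently large (depending on L), and let λ_k be sufficiently small (depending on
L, M)"*), Theorem 2 / Corollary 1 (TeX L2452–2505: *"Let μ̄ = 1 and let λ be sufficiently small"*), and the
convention TeX L386–388 (*"𝒪(1) stands for a generic constant independent of all parameters, C stands for a generic
constant possibly depending on L"*).  TeX line numbers refer to the cell's held source
`inputs/files/dimock/src/1304.0705/1304.0705.tex`.

**Why this module.**  This lineage's kernel end chain — `Phi43PolymerRepresentation` → `ThreeSortedResummation` →
`HoleSummability` → `HistorySum` → `LargeFieldRegionVolume.stability_of_regions` — turns every *"sufficiently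
small / large"* of the printed §3 into NAMED inequalities: the structure `HistorySum.LargeLog Cr c₂ p₀ A M κ λ r n₀ L`
(at `A = RegionVolume.A14 r`), the rate conditions `κ′ ≤ κ − 1`, `κ₀(32,6) ≤ κ₀`, `κ₁(3) ≤ κ₀`, `κ₀ ≤ κ′`, `κ₀(32,6) ≤ r₁`,
`r₁ + 2κ₀(32,6) + 2 ≤ κ′ − κ₀ − 1`, and the smallness conditions `λ^{β/2}e^{2(κ′−κ₀)} ≤ 1`, `32(K₀ + CK₀ + CK₁)λ^{β/2} ≤ 1`,
`e^{1/4}λ^{β/2}e^{5r₁+1}K₀·32 ≤ 1` (`K₀ = K₀(32,6)`, `K₁ = K₁(3)` the cell's explicit lattice-animal constants).  A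
theorem with many explicit hypotheses is only as good as their joint satisfiability; this module certifies it, in the
print's own order of quantifiers: for ANY `L` with `log L ≥ 1`, any constants `C, Cr ≥ 0`, `c₂ > 0`, `M ≥ 0`, any
`n₀ ≥ 4`, `0 < β ≤ n₀`, and exponents with `3r + 2 < 2p₀` (TeX L2287 *"We can assume 3r+2 < 2p₀"*), there are rates
`κ₀, κ′, κ, r₁` satisfying the six rate conditions such that ALL the `λ`-dependent conditions hold for every `λ` in a
right-neighbourhood of `0` (`∀ᶠ λ in 𝓝[>] 0`) — i.e. *"for λ sufficiently small (depending on L, M)"*.  (The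
remaining hypothesis `hM` of `stability_of_regions`, `e·32·K₀²·e^{1/4}·K₀ ≤ (L^m)³`, involves neither `λ` nor the rates
and is the print's *"M sufficiently large"*; the three analytic shapes (stingray)/(under)/(randall) are about the model's
activities and are not parameters.)

**What is proved (Mathlib + the imported cell modules only).**  `rates_exist` (the six λ-free rate conditions are
satisfiable above any two given thresholds), `eventually_largeLog` (`LargeLog … λ …` for `λ → 0⁺`),
`eventually_smallness` (the three `λ^{β/2}`-conditions for `λ → 0⁺`), and the package `regime_nonempty`; v1.1 Part 5 adds
the explicit thresholds (`ellLog`, `ellSmall`, `ellStar`, `regime_explicit`, `hM_of_le`), v1.2 Part 6 the discharged top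
statement `stability_of_regions_explicit`, see below.  Tools:
`Real.tendsto_log_nhdsGT_zero`, `tendsto_rpow_atTop`, `Real.continuousAt_rpow_const`, `Filter.Tendsto.eventually_ge_atTop`,
`Filter.Tendsto.eventually_le_const`.  [folklore] throughout: elementary limits; nothing of the papers is asserted.

**v1.1 (Part 5, append-only; gen 18).**  THE REGIME MADE EXPLICIT: closed-form thresholds replace the filters —
`powThreshold X c q = (max X 0 / c)^{1/q}` (after which `X ≤ c·ℓ^q`) and `expThreshold X s = log(max X 1)/s` (after which
`X·e^{−sℓ} ≤ 1`, i.e. `X·λ^s ≤ 1` at `ℓ = −log λ`); `ellLog` (the six `λ`-clauses of `LargeLog` — `ell₀`, `first`, `kappa`, `power`,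
`slot`, `nine`: `max(2, log 9, four power thresholds)`) with `largeLog_of_ellLog_le`; `ellSmall` (the three `λ^{β/2}`-conditions) with `smallness_of_ellSmall_le`; the
explicit rates `kappa0Star = max(κ₀(32,6), κ₁(3))`, `r1Star = κ₀(32,6)`, `kappaPrimeStar = κ₀⋆ + 3κ₀(32,6) + 3`, `kappaStar =
κ′⋆ + 1` with `rates_explicit`; `ellStar = max(ellLog …, ellSmall …)` and **`regime_explicit`**: for EVERY `λ` with `0 < λ ≤
exp(−ellStar C Cr c₂ M p₀ β r n₀)` all `λ`-dependent side conditions of `stability_of_regions` hold (the quantitative form of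
`regime_nonempty`); and **`hM_of_le`**: the `λ`-free clause `hM` («M sufficiently large (depending on L)») holds as soon as
`3m·log L ≥ 5/4 + 3κ₀(32,6)`.  [folklore] real arithmetic throughout (`Real.rpow_inv_rpow`, `Real.log_le_iff_le_exp`,
`Real.exp_le_exp`); nothing of the papers is asserted.  Numeric reading of the thresholds (two engines, cell records GAPS
C-tmpl18-2 / TEMPLATE.md v8.22): with the cell's unoptimised constants `κ₀(32,6) = 32 log 98 ≈ 146.72`, `log K₀(32,6) ≈ 142.83`,
`κ₁(3) ≈ 390.71`, `A14 1 = 18 821 096`, the `M`-clause `hM` itself needs `M = L^m ≥ 10^{62.71}` (at `L = 3`: `m ≥ 132`) while the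
sufficient condition of `hM_of_le` reads `L^m ≥ 10^{63.90}` (at `L = 3`: `m ≥ 134`), the three smallness
thresholds are `−log λ ≥ 1772.6 / 384.3 / 1762.3` (`β = 1`, `C = 1`), and the `first` clause of `LargeLog` contributes
`(3·Cr·A14 r·M³/c₂)^{1/(2p₀−3r−2)}` — at `(L, m, r, Cr, c₂) = (3, 134, 1, 1, 1)`: `≈ 10^{199.6}` for `p₀ = 3`, `≈ 2.0·10^{13}` for
`p₀ = 10`, `≈ 10.6` for `p₀ = 100` (then `ellStar = 1772.6`, i.e. `λ ≤ e^{−1773}`).  These sizes are artefacts of the explicit,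
unoptimised lattice-animal constants (cf. `HoleSummability` header (iii)) and immaterial to the qualitative chain.

**v1.2 (Part 6, append-only; gen 18).**  **`stability_of_regions_explicit`**: `RegionVolume.stability_of_regions` with its
six rate conditions, its `LargeLog` hypothesis, its three smallness conditions and its `M`-clause DISCHARGED by Part 5 at
the explicit rates — the end chain's top statement ((stingray) ∧ (under) ∧ (randall) ⇒ Corollary 1) now asks of the
parameters only `log L ≥ 1`, signs, `n₀ ≥ 4`, `0 < β ≤ n₀`, `3r + 2 < 2p₀`, `0 < λ ≤ exp(−ellStar …)`, `3m·log L ≥ 5/4 +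
3κ₀(32,6)`, and of the model exactly the three analytic shapes (with (under)'s decay rate instantiated at κ′⋆).

**What is NOT claimed.**  Nothing about the analytic shapes; nothing Bałaban-side; no optimality of any threshold.  Value =
non-vacuity certificate of the template's kernel end chain with its regime written out, NOT summit progress.

Cell records: GAPS.md C-tmpl17-1, C-tmpl17-2 (the end chain), this module's rows C-tmpl17-3 (v1) and C-tmpl18-2 (v1.1);
unit `b2b-balaban-template` gens 17–19 (v1.2: row C-tmpl18-4; v1.3: DOCSTRING-ONLY fold of XREAD C-pv10-82 remarks R1/R2 —
`hM` vs `hM_of_le` thresholds distinguished, «six» λ-clauses; v1.4: DOCSTRING-ONLY fold of XREAD C-ref5-158's LOW locator —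
the Part 6 docstring now places *"let λ be sufficiently small"* at Theorem 2, TeX L2452, inherited by Corollary 1, row
C-tmpl19-2).  Leaf; imports `…Dimock2011to13.LargeFieldRegionVolume` only; sub-namespace `…Dimock2011to13.EndChainRegime`;
v1.1/v1.2 are APPEND-ONLY (Part 5 / Part 6 + this docstring; earlier Parts byte-identical), v1.3/v1.4 change docstrings
only; modifies nothing else.
-/

noncomputable section

open Real Filter Topology
open Literature.MathematicalPhysics.QuantumFieldTheory.Balaban1983to89.B12TreeDecay (kappa₀ K₀ kappa₀_nonneg)
open Literature.MathematicalPhysics.QuantumFieldTheory.Dimock2011to13.HoleSummability (kappa₁ K₁)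
open Literature.MathematicalPhysics.QuantumFieldTheory.Dimock2011to13.HistorySum (LargeLog)
open Literature.MathematicalPhysics.QuantumFieldTheory.Dimock2011to13.RegionVolume (A14 A14_pos)

namespace Literature.MathematicalPhysics.QuantumFieldTheory.Dimock2011to13.EndChainRegime

/-! ## Part 1. Elementary limits as `λ → 0⁺` -/

/-- `−log λ → +∞` as `λ → 0⁺`. [folklore] -/
theorem tendsto_negLog : Tendsto (fun lam : ℝ => -Real.log lam) (𝓝[>] 0) atTop :=
  tendsto_neg_atBot_atTop.comp Real.tendsto_log_nhdsGT_zero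

/-- `c·(−log λ)^q → +∞` as `λ → 0⁺`, for `c, q > 0`. [folklore] -/
theorem tendsto_const_mul_negLog_rpow {c q : ℝ} (hc : 0 < c) (hq : 0 < q) :
    Tendsto (fun lam : ℝ => c * (-Real.log lam) ^ q) (𝓝[>] 0) atTop :=
  Tendsto.const_mul_atTop hc ((tendsto_rpow_atTop hq).comp tendsto_negLog)

/-- Eventually `X ≤ c·(−log λ)^q` (`c, q > 0`). [folklore] -/
theorem eventually_le_const_mul_negLog_rpow (X : ℝ) {c q : ℝ} (hc : 0 < c) (hq : 0 < q) :
    ∀ᶠ lam in 𝓝[>] (0 : ℝ), X ≤ c * (-Real.log lam) ^ q :=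
  (tendsto_const_mul_negLog_rpow hc hq).eventually_ge_atTop X

/-- `λ^s → 0` as `λ → 0⁺`, for `s > 0`. [folklore] -/
theorem tendsto_rpow_nhdsGT_zero {s : ℝ} (hs : 0 < s) :
    Tendsto (fun lam : ℝ => lam ^ s) (𝓝[>] 0) (𝓝 0) := by
  have h := (Real.continuousAt_rpow_const 0 s (Or.inr hs.le)).tendsto
  rw [Real.zero_rpow hs.ne'] at h
  exact h.mono_left nhdsWithin_le_nhds

/-- Eventually `X·λ^s ≤ 1` (`s > 0`). [folklore] -/
theorem eventually_const_mul_rpow_le_one (X : ℝ) {s : ℝ} (hs : 0 < s) :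
    ∀ᶠ lam in 𝓝[>] (0 : ℝ), X * lam ^ s ≤ 1 := by
  have h : Tendsto (fun lam : ℝ => X * lam ^ s) (𝓝[>] 0) (𝓝 (X * 0)) :=
    (tendsto_rpow_nhdsGT_zero hs).const_mul X
  rw [mul_zero] at h
  exact h.eventually_le_const zero_lt_one

/-- Eventually `9λ^{n₀} ≤ 1` (`n₀ ≥ 1`). [folklore] -/
theorem eventually_nine_pow_le_one {n₀ : ℕ} (hn₀ : 1 ≤ n₀) :
    ∀ᶠ lam in 𝓝[>] (0 : ℝ), 9 * lam ^ n₀ ≤ 1 := by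
  have h : Tendsto (fun lam : ℝ => 9 * lam ^ n₀) (𝓝[>] 0) (𝓝 (9 * (0 : ℝ) ^ n₀)) :=
    (((continuous_pow n₀).tendsto 0).mono_left nhdsWithin_le_nhds).const_mul 9
  rw [zero_pow (by omega), mul_zero] at h
  exact h.eventually_le_const zero_lt_one

/-- Eventually `0 < λ` on `𝓝[>] 0`. [folklore] -/
theorem eventually_pos : ∀ᶠ lam in 𝓝[>] (0 : ℝ), 0 < lam :=
  eventually_nhdsWithin_of_forall fun _ hx => hx

/-! ## Part 2. The `λ`-free rate conditions -/

/-- THE SIX RATE CONDITIONS of `stability_of_regions` are satisfiable above any thresholds: with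
`κ₀ := max(κ₀(32,6), κ₁(3))`, `r₁ := κ₀(32,6)`, `κ′ := κ₀ + r₁ + 2κ₀(32,6) + 3`, `κ := κ′ + 1`. [folklore] -/
theorem rates_exist :
    ∃ κ₀ κ' κ r₁ : ℝ, κ' ≤ κ - 1 ∧ kappa₀ 32 6 ≤ κ₀ ∧ kappa₁ 3 ≤ κ₀ ∧ κ₀ ≤ κ' ∧ kappa₀ 32 6 ≤ r₁ ∧
      r₁ + 2 * kappa₀ 32 6 + 2 ≤ κ' - κ₀ - 1 ∧ 0 ≤ κ₀ ∧ 0 ≤ κ := by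
  have h0 : 0 ≤ kappa₀ 32 6 := kappa₀_nonneg (by norm_num) 6
  refine ⟨max (kappa₀ 32 6) (kappa₁ 3), max (kappa₀ 32 6) (kappa₁ 3) + kappa₀ 32 6 + 2 * kappa₀ 32 6 + 3,
    max (kappa₀ 32 6) (kappa₁ 3) + kappa₀ 32 6 + 2 * kappa₀ 32 6 + 3 + 1, kappa₀ 32 6,
    by linarith, le_max_left _ _, le_max_right _ _, by linarith, le_rfl, by linarith,
    h0.trans (le_max_left _ _), ?_⟩
  have := h0.trans (le_max_left (kappa₀ 32 6) (kappa₁ 3))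
  linarith

/-! ## Part 3. `LargeLog` and the smallness conditions for `λ → 0⁺` -/

/-- **`HistorySum.LargeLog Cr c₂ p₀ A M κ λ r n₀ L` HOLDS FOR `λ` SMALL** (all other arguments fixed), provided `log L ≥ 1`,
`Cr ≥ 0`, `c₂ > 0`, `A > 0`, `M ≥ 0`, `κ ≥ 0`, `n₀ ≥ 4`, `3r + 2 < 2p₀` — [Dimock2013BalabanIII] TeX L2287 *"We can assume
3r+2 < 2p₀. Then for −log λ and hence −log λ_j sufficiently large, …"*. [cite: Dimock2013BalabanIII, §3.5 proof of Lemma 15 (arXiv:1304.0705v1 TeX L2287–2299)] -/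
theorem eventually_largeLog {L : ℕ} (hL : 1 ≤ Real.log L) {Cr c₂ p₀ A M κ : ℝ} {r n₀ : ℕ}
    (hCr : 0 ≤ Cr) (hc₂ : 0 < c₂) (hA : 0 < A) (hM : 0 ≤ M) (hκ : 0 ≤ κ) (hn₀ : 4 ≤ n₀)
    (hexp : (3 * r + 2 : ℝ) < 2 * p₀) :
    ∀ᶠ lam in 𝓝[>] (0 : ℝ), LargeLog Cr c₂ p₀ A M κ lam r n₀ L := by
  have hc6 : 0 < c₂ / (6 * A) := by positivity
  have e1 := eventually_pos
  have e2 := tendsto_negLog.eventually_ge_atTop (2 : ℝ)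
  have e3 := eventually_le_const_mul_negLog_rpow (3 * Cr * A * M ^ 3) hc₂ (by linarith : (0 : ℝ) < 2 * p₀ - (3 * r + 2))
  have e4 := eventually_le_const_mul_negLog_rpow κ hc6 (by linarith : (0 : ℝ) < 2 * p₀ - 3 * r)
  have e5 := eventually_le_const_mul_negLog_rpow (n₀ : ℝ) hc6 (by linarith : (0 : ℝ) < 2 * p₀ - 3 * r - 1)
  have e6 := eventually_le_const_mul_negLog_rpow (3 * (n₀ : ℝ)) hc₂
    (by have : (0 : ℝ) ≤ r := Nat.cast_nonneg r; linarith : (0 : ℝ) < 2 * p₀ - 1)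
  have e7 := eventually_nine_pow_le_one (by omega : 1 ≤ n₀)
  filter_upwards [e1, e2, e3, e4, e5, e6, e7] with lam h1 h2 h3 h4 h5 h6 h7
  exact
    { C_nonneg := hCr
      c₂_nonneg := hc₂.le
      A_pos := hA
      M_nonneg := hM
      κ_nonneg := hκ
      lam_pos := h1
      n₀_four := hn₀
      logL := hL
      ell₀ := h2
      exps := hexp.le
      first := h3
      kappa := h4
      power := h5
      slot := h6
      nine := h7 }

/-- THE THREE SMALLNESS CONDITIONS of `stability_of_regions` hold for `λ` small (`β > 0`; any `C`, `κ′ − κ₀`, `r₁`). [folklore] -/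
theorem eventually_smallness {β C κ' κ₀ r₁ : ℝ} (hβ : 0 < β) :
    ∀ᶠ lam in 𝓝[>] (0 : ℝ),
      lam ^ (β / 2) * Real.exp (2 * (κ' - κ₀)) ≤ 1 ∧
      32 * (K₀ 32 6 + C * K₀ 32 6 + C * K₁ 3) * lam ^ (β / 2) ≤ 1 ∧
      Real.exp (1 / 4) * lam ^ (β / 2) * Real.exp (5 * r₁ + 1) * K₀ 32 6 * 32 ≤ 1 := by
  have hs : 0 < β / 2 := by linarith
  have e1 := eventually_const_mul_rpow_le_one (Real.exp (2 * (κ' - κ₀))) hs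
  have e2 := eventually_const_mul_rpow_le_one (32 * (K₀ 32 6 + C * K₀ 32 6 + C * K₁ 3)) hs
  have e3 := eventually_const_mul_rpow_le_one (Real.exp (1 / 4) * Real.exp (5 * r₁ + 1) * K₀ 32 6 * 32) hs
  filter_upwards [e1, e2, e3] with lam h1 h2 h3
  refine ⟨by linarith [mul_comm (lam ^ (β / 2)) (Real.exp (2 * (κ' - κ₀)))], h2, ?_⟩
  calc Real.exp (1 / 4) * lam ^ (β / 2) * Real.exp (5 * r₁ + 1) * K₀ 32 6 * 32
      = Real.exp (1 / 4) * Real.exp (5 * r₁ + 1) * K₀ 32 6 * 32 * lam ^ (β / 2) := by ring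
    _ ≤ 1 := h3

/-! ## Part 4. The regime is non-empty -/

/-- **THE PARAMETER REGIME OF `RegionVolume.stability_of_regions` IS NON-EMPTY** — in the print's order of quantifiers
([Dimock2013BalabanIII] Theorem 1, TeX L265–270: *"Let L be sufficiently large, let M be sufficiently large (depending on
L), and let λ_k be sufficiently small (depending on L, M)"*): for every `L` with `log L ≥ 1`, all constants `C, Cr ≥
0`, `c₂ > 0`, `M ≥ 0`, every `n₀ ≥ 4`, `0 < β ≤ n₀` and exponents with `3r + 2 < 2p₀`, there are rates `κ₀, κ′, κ, r₁`
satisfying the six rate conditions of `stability_of_regions`, and then `LargeLog Cr c₂ p₀ (A14 r) M κ λ r n₀ L` together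
with the three `λ^{β/2}`-smallness conditions hold for all `λ` in a right-neighbourhood of `0`.  (The hypothesis `hM` of
`stability_of_regions` is `λ`- and rate-free — the print's *"M sufficiently large"* — and `hβn₀ : β ≤ n₀` is carried as
given.) [cite: Dimock2013BalabanIII, Theorem 1 (arXiv:1304.0705v1 TeX L265–270)] -/
theorem regime_nonempty {L : ℕ} (hL : 1 ≤ Real.log L) {C Cr c₂ M p₀ β : ℝ} {r n₀ : ℕ}
    (hC : 0 ≤ C) (hCr : 0 ≤ Cr) (hc₂ : 0 < c₂) (hM : 0 ≤ M) (hn₀ : 4 ≤ n₀) (hβ : 0 < β)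
    (hexp : (3 * r + 2 : ℝ) < 2 * p₀) :
    ∃ κ₀ κ' κ r₁ : ℝ,
      (κ' ≤ κ - 1 ∧ kappa₀ 32 6 ≤ κ₀ ∧ kappa₁ 3 ≤ κ₀ ∧ κ₀ ≤ κ' ∧ kappa₀ 32 6 ≤ r₁ ∧
        r₁ + 2 * kappa₀ 32 6 + 2 ≤ κ' - κ₀ - 1 ∧ 0 ≤ C) ∧
      ∀ᶠ lam in 𝓝[>] (0 : ℝ),
        LargeLog Cr c₂ p₀ (A14 r) M κ lam r n₀ L ∧
        lam ^ (β / 2) * Real.exp (2 * (κ' - κ₀)) ≤ 1 ∧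
        32 * (K₀ 32 6 + C * K₀ 32 6 + C * K₁ 3) * lam ^ (β / 2) ≤ 1 ∧
        Real.exp (1 / 4) * lam ^ (β / 2) * Real.exp (5 * r₁ + 1) * K₀ 32 6 * 32 ≤ 1 := by
  obtain ⟨κ₀, κ', κ, r₁, h1, h2, h3, h4, h5, h6, -, hκ⟩ := rates_exist
  refine ⟨κ₀, κ', κ, r₁, ⟨h1, h2, h3, h4, h5, h6, hC⟩, ?_⟩
  filter_upwards [eventually_largeLog hL hCr hc₂ (A14_pos r) hM hκ hn₀ hexp,
    eventually_smallness (C := C) (κ' := κ') (κ₀ := κ₀) (r₁ := r₁) hβ] with lam ha hb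
  exact ⟨ha, hb⟩

/-! ## Part 5. (v1.1) The regime made EXPLICIT: a closed-form threshold `ℓ⋆` with
`−log λ ≥ ℓ⋆ ⟹` every `λ`-dependent side condition, and a closed-form `m`-threshold for «M sufficiently large» -/

/-- The threshold after which `X ≤ c·ℓ^q` holds: `(max X 0 / c)^{1/q}`. [folklore] -/
def powThreshold (X c q : ℝ) : ℝ := (max X 0 / c) ^ (1 / q)

/-- `powThreshold X c q ≥ 0` for `c > 0`. [folklore] -/
theorem powThreshold_nonneg (X c q : ℝ) (hc : 0 < c) : 0 ≤ powThreshold X c q := by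
  unfold powThreshold
  exact Real.rpow_nonneg (div_nonneg (le_max_right _ _) hc.le) _

/-- `powThreshold X c q ≤ ℓ ⟹ X ≤ c·ℓ^q` (`c, q > 0`). [folklore] -/
theorem le_const_mul_rpow_of_powThreshold_le {X c q ℓ : ℝ} (hc : 0 < c) (hq : 0 < q)
    (h : powThreshold X c q ≤ ℓ) : X ≤ c * ℓ ^ q := by
  have h0 : 0 ≤ max X 0 / c := div_nonneg (le_max_right _ _) hc.le
  have hth : 0 ≤ powThreshold X c q := powThreshold_nonneg X c q hc
  have h1 : (powThreshold X c q) ^ q = max X 0 / c := by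
    unfold powThreshold
    rw [one_div, Real.rpow_inv_rpow h0 hq.ne']
  have h2 : max X 0 / c ≤ ℓ ^ q := by
    rw [← h1]
    exact Real.rpow_le_rpow hth h hq.le
  have h3 : max X 0 ≤ c * ℓ ^ q := by
    have := mul_le_mul_of_nonneg_left h2 hc.le
    rwa [mul_div_cancel₀ _ hc.ne'] at this
  exact (le_max_left X 0).trans h3

/-- The threshold after which `X·e^{−sℓ} ≤ 1` holds: `log(max X 1)/s`. [folklore] -/
def expThreshold (X s : ℝ) : ℝ := Real.log (max X 1) / s

/-- `expThreshold X s ≥ 0` for `s > 0`. [folklore] -/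
theorem expThreshold_nonneg (X s : ℝ) (hs : 0 < s) : 0 ≤ expThreshold X s :=
  div_nonneg (Real.log_nonneg (le_max_right _ _)) hs.le

/-- `expThreshold X s ≤ ℓ ⟹ X·exp(−sℓ) ≤ 1` (`s > 0`). [folklore] -/
theorem mul_exp_neg_le_one_of_expThreshold_le {X s ℓ : ℝ} (hs : 0 < s) (h : expThreshold X s ≤ ℓ) :
    X * Real.exp (-(s * ℓ)) ≤ 1 := by
  have h1 : Real.log (max X 1) ≤ s * ℓ := by
    unfold expThreshold at h
    rwa [div_le_iff₀ hs, mul_comm] at h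
  have hpos : 0 < max X 1 := lt_of_lt_of_le one_pos (le_max_right _ _)
  have h2 : max X 1 ≤ Real.exp (s * ℓ) := by
    rw [← Real.log_le_iff_le_exp hpos]; exact h1
  have h3 : X ≤ Real.exp (s * ℓ) := (le_max_left X 1).trans h2
  rw [Real.exp_neg]
  have hE : 0 < Real.exp (s * ℓ) := Real.exp_pos _
  calc X * (Real.exp (s * ℓ))⁻¹ ≤ Real.exp (s * ℓ) * (Real.exp (s * ℓ))⁻¹ :=
        mul_le_mul_of_nonneg_right h3 (inv_nonneg.mpr hE.le)
    _ = 1 := mul_inv_cancel₀ hE.ne'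

/-- For `λ > 0`: `λ^s = exp(−s·(−log λ))`. [folklore] -/
theorem rpow_eq_exp_neg {lam s : ℝ} (hlam : 0 < lam) :
    lam ^ s = Real.exp (-(s * (-Real.log lam))) := by
  rw [Real.rpow_def_of_pos hlam]; congr 1; ring

/-- `expThreshold X s ≤ −log λ ⟹ X·λ^s ≤ 1` (`λ, s > 0`). [folklore] -/
theorem mul_rpow_le_one_of_expThreshold_le {X s lam : ℝ} (hlam : 0 < lam) (hs : 0 < s)
    (h : expThreshold X s ≤ -Real.log lam) : X * lam ^ s ≤ 1 := by
  rw [rpow_eq_exp_neg hlam]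
  exact mul_exp_neg_le_one_of_expThreshold_le hs h

/-- THE EXPLICIT `−log λ`-THRESHOLD OF `LargeLog Cr c₂ p₀ A M κ λ r n₀ L` (the six `λ`-clauses `ell₀`, `first`,
`kappa`, `power`, `slot`, `nine`): `max(2, log 9, …four power thresholds…)`. [folklore] -/
def ellLog (Cr c₂ p₀ A M κ : ℝ) (r n₀ : ℕ) : ℝ :=
  max 2 (max (Real.log 9) (max (powThreshold (3 * Cr * A * M ^ 3) c₂ (2 * p₀ - (3 * r + 2)))
    (max (powThreshold κ (c₂ / (6 * A)) (2 * p₀ - 3 * r))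
      (max (powThreshold n₀ (c₂ / (6 * A)) (2 * p₀ - 3 * r - 1)) (powThreshold (3 * n₀) c₂ (2 * p₀ - 1))))))

/-- **`LargeLog` FROM THE EXPLICIT THRESHOLD**: if `log L ≥ 1`, `Cr ≥ 0`, `c₂ > 0`, `A > 0`, `M ≥ 0`, `κ ≥ 0`, `n₀ ≥ 4`,
`3r + 2 < 2p₀` and `−log λ ≥ ellLog Cr c₂ p₀ A M κ r n₀` (`λ > 0`), then `LargeLog Cr c₂ p₀ A M κ λ r n₀ L` — the print's
*"for −log λ … sufficiently large"* ([Dimock2013BalabanIII] TeX L2287) with the threshold written out. [folklore] -/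
theorem largeLog_of_ellLog_le {L : ℕ} (hL : 1 ≤ Real.log L) {Cr c₂ p₀ A M κ lam : ℝ} {r n₀ : ℕ}
    (hCr : 0 ≤ Cr) (hc₂ : 0 < c₂) (hA : 0 < A) (hM : 0 ≤ M) (hκ : 0 ≤ κ) (hn₀ : 4 ≤ n₀)
    (hexp : (3 * r + 2 : ℝ) < 2 * p₀) (hlam : 0 < lam) (hℓ : ellLog Cr c₂ p₀ A M κ r n₀ ≤ -Real.log lam) :
    LargeLog Cr c₂ p₀ A M κ lam r n₀ L := by
  have hc6 : 0 < c₂ / (6 * A) := by positivity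
  have hr0 : (0 : ℝ) ≤ r := Nat.cast_nonneg r
  have e2 : 2 ≤ -Real.log lam := le_trans (le_max_left _ _) hℓ
  have hrest := le_trans (le_max_right _ _) hℓ
  have e9 : Real.log 9 ≤ -Real.log lam := le_trans (le_max_left _ _) hrest
  have hrest2 := le_trans (le_max_right _ _) hrest
  have e3 : powThreshold (3 * Cr * A * M ^ 3) c₂ (2 * p₀ - (3 * r + 2)) ≤ -Real.log lam :=
    le_trans (le_max_left _ _) hrest2
  have hrest3 := le_trans (le_max_right _ _) hrest2
  have e4 : powThreshold κ (c₂ / (6 * A)) (2 * p₀ - 3 * r) ≤ -Real.log lam := le_trans (le_max_left _ _) hrest3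
  have hrest4 := le_trans (le_max_right _ _) hrest3
  have e5 : powThreshold n₀ (c₂ / (6 * A)) (2 * p₀ - 3 * r - 1) ≤ -Real.log lam := le_trans (le_max_left _ _) hrest4
  have e6 : powThreshold (3 * n₀) c₂ (2 * p₀ - 1) ≤ -Real.log lam := le_trans (le_max_right _ _) hrest4
  -- nine: 9 λ^{n₀} ≤ 1 from −log λ ≥ log 9
  have hlam1 : lam ≤ 1 := by
    have : 0 ≤ -Real.log lam := le_trans (by norm_num) e2
    have : Real.log lam ≤ 0 := by linarith
    exact (Real.log_nonpos_iff hlam.le).mp this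
  have h9lam : 9 * lam ≤ 1 := by
    have h1 : Real.log 9 ≤ -Real.log lam := e9
    have h2 : Real.log (9 * lam) ≤ 0 := by
      rw [Real.log_mul (by norm_num) hlam.ne']; linarith
    have h3 : 0 < 9 * lam := by positivity
    have := Real.exp_le_exp.mpr h2
    rwa [Real.exp_log h3, Real.exp_zero] at this
  have h7 : 9 * lam ^ n₀ ≤ 1 := by
    have hp : lam ^ n₀ ≤ lam := by
      calc lam ^ n₀ ≤ lam ^ 1 := pow_le_pow_of_le_one hlam.le hlam1 (by omega)
        _ = lam := pow_one lam
    nlinarith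
  exact
    { C_nonneg := hCr
      c₂_nonneg := hc₂.le
      A_pos := hA
      M_nonneg := hM
      κ_nonneg := hκ
      lam_pos := hlam
      n₀_four := hn₀
      logL := hL
      ell₀ := e2
      exps := hexp.le
      first := le_const_mul_rpow_of_powThreshold_le hc₂ (by linarith) e3
      kappa := le_const_mul_rpow_of_powThreshold_le hc6 (by linarith) e4
      power := le_const_mul_rpow_of_powThreshold_le hc6 (by linarith) e5
      slot := le_const_mul_rpow_of_powThreshold_le hc₂ (by linarith) e6
      nine := h7 }


/-- THE EXPLICIT `−log λ`-THRESHOLD OF THE THREE SMALLNESS CONDITIONS of `stability_of_regions` (`hsmall`, `htoot`, `hKP`):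
each is `X·λ^{β/2} ≤ 1`, true once `−log λ ≥ (2/β)·log max(X, 1)`. [folklore] -/
def ellSmall (β C κ' κ₀ r₁ : ℝ) : ℝ :=
  max (expThreshold (Real.exp (2 * (κ' - κ₀))) (β / 2))
    (max (expThreshold (32 * (K₀ 32 6 + C * K₀ 32 6 + C * K₁ 3)) (β / 2))
      (expThreshold (Real.exp (1 / 4) * Real.exp (5 * r₁ + 1) * K₀ 32 6 * 32) (β / 2)))

/-- **THE THREE SMALLNESS CONDITIONS FROM THE EXPLICIT THRESHOLD** (`β > 0`, `λ > 0`,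
`−log λ ≥ ellSmall β C κ′ κ₀ r₁`). [folklore] -/
theorem smallness_of_ellSmall_le {β C κ' κ₀ r₁ lam : ℝ} (hβ : 0 < β) (hlam : 0 < lam)
    (hℓ : ellSmall β C κ' κ₀ r₁ ≤ -Real.log lam) :
    lam ^ (β / 2) * Real.exp (2 * (κ' - κ₀)) ≤ 1 ∧
      32 * (K₀ 32 6 + C * K₀ 32 6 + C * K₁ 3) * lam ^ (β / 2) ≤ 1 ∧
      Real.exp (1 / 4) * lam ^ (β / 2) * Real.exp (5 * r₁ + 1) * K₀ 32 6 * 32 ≤ 1 := by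
  have hs : 0 < β / 2 := by linarith
  have e1 := le_trans (le_max_left _ _) hℓ
  have hrest := le_trans (le_max_right _ _) hℓ
  have e2 := le_trans (le_max_left _ _) hrest
  have e3 := le_trans (le_max_right _ _) hrest
  have h1 := mul_rpow_le_one_of_expThreshold_le hlam hs e1
  have h2 := mul_rpow_le_one_of_expThreshold_le hlam hs e2
  have h3 := mul_rpow_le_one_of_expThreshold_le hlam hs e3
  refine ⟨by linarith [mul_comm (lam ^ (β / 2)) (Real.exp (2 * (κ' - κ₀)))], h2, ?_⟩
  calc Real.exp (1 / 4) * lam ^ (β / 2) * Real.exp (5 * r₁ + 1) * K₀ 32 6 * 32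
      = Real.exp (1 / 4) * Real.exp (5 * r₁ + 1) * K₀ 32 6 * 32 * lam ^ (β / 2) := by ring
    _ ≤ 1 := h3

/-- **«M SUFFICIENTLY LARGE (DEPENDING ON L)» MADE EXPLICIT**: the `λ`- and rate-free hypothesis `hM` of
`stability_of_regions`, `e·32·K₀(32,6)²·e^{1/4}·K₀(32,6) ≤ (L^m)³`, holds as soon as `3m·log L ≥ 5/4 + 3κ₀(32,6)`
(`K₀(32,6) = e^{κ₀(32,6)}/49`, and `32/49³ ≤ 1`). [cite: Dimock2013BalabanIII, Theorem 1 «let M be sufficiently large (depending on L)» (arXiv:1304.0705v1 TeX L265–270)] -/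
theorem hM_of_le {L m : ℕ} (hL : 0 < (L : ℝ)) (hm : 5 / 4 + 3 * kappa₀ 32 6 ≤ 3 * m * Real.log L) :
    Real.exp 1 * 32 * K₀ 32 6 ^ 2 * Real.exp (1 / 4) * K₀ 32 6 ≤ ((L : ℝ) ^ m) ^ 3 := by
  have hK : K₀ 32 6 = Real.exp (kappa₀ 32 6) / 49 := by
    simp only [K₀]; norm_num
  have hrhs : ((L : ℝ) ^ m) ^ 3 = Real.exp (3 * m * Real.log L) := by
    rw [← pow_mul, ← Real.exp_log (pow_pos hL (m * 3)), Real.log_pow]; congr 1; push_cast; ring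
  have hlhs : Real.exp 1 * 32 * K₀ 32 6 ^ 2 * Real.exp (1 / 4) * K₀ 32 6
      = (32 / 49 ^ 3) * Real.exp (5 / 4 + 3 * kappa₀ 32 6) := by
    rw [hK]
    have : Real.exp (5 / 4 + 3 * kappa₀ 32 6) = Real.exp 1 * Real.exp (1 / 4) * Real.exp (kappa₀ 32 6) ^ 3 := by
      rw [← Real.exp_add, ← Real.exp_nat_mul, ← Real.exp_add]; congr 1; push_cast; ring
    rw [this]; ring
  rw [hrhs, hlhs]
  calc (32 / 49 ^ 3 : ℝ) * Real.exp (5 / 4 + 3 * kappa₀ 32 6)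
      ≤ 1 * Real.exp (5 / 4 + 3 * kappa₀ 32 6) :=
        mul_le_mul_of_nonneg_right (by norm_num) (Real.exp_pos _).le
    _ = Real.exp (5 / 4 + 3 * kappa₀ 32 6) := one_mul _
    _ ≤ Real.exp (3 * m * Real.log L) := Real.exp_le_exp.mpr hm

/-- The explicit rates of `rates_exist`: `κ₀⋆ := max(κ₀(32,6), κ₁(3))`. [folklore] -/
def kappa0Star : ℝ := max (kappa₀ 32 6) (kappa₁ 3)
/-- `r₁⋆ := κ₀(32,6)`. [folklore] -/
def r1Star : ℝ := kappa₀ 32 6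
/-- `κ′⋆ := κ₀⋆ + 3κ₀(32,6) + 3`. [folklore] -/
def kappaPrimeStar : ℝ := kappa0Star + kappa₀ 32 6 + 2 * kappa₀ 32 6 + 3
/-- `κ⋆ := κ′⋆ + 1`. [folklore] -/
def kappaStar : ℝ := kappaPrimeStar + 1

/-- The explicit rates satisfy the six rate conditions of `stability_of_regions`. [folklore] -/
theorem rates_explicit :
    kappaPrimeStar ≤ kappaStar - 1 ∧ kappa₀ 32 6 ≤ kappa0Star ∧ kappa₁ 3 ≤ kappa0Star ∧ kappa0Star ≤ kappaPrimeStar ∧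
      kappa₀ 32 6 ≤ r1Star ∧ r1Star + 2 * kappa₀ 32 6 + 2 ≤ kappaPrimeStar - kappa0Star - 1 ∧
      0 ≤ kappa0Star ∧ 0 ≤ kappaStar := by
  have h0 : 0 ≤ kappa₀ 32 6 := kappa₀_nonneg (by norm_num) 6
  have h1 : 0 ≤ kappa0Star := h0.trans (le_max_left _ _)
  refine ⟨by simp [kappaStar], le_max_left _ _, le_max_right _ _, ?_, le_rfl, ?_, h1, ?_⟩
  · simp only [kappaPrimeStar]; linarith
  · simp only [kappaPrimeStar, r1Star]; linarith
  · simp only [kappaStar, kappaPrimeStar]; linarith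

/-- THE TOTAL THRESHOLD `ℓ⋆(L-free data)`: `max(ellLog …, ellSmall …)` at the explicit rates and `A = A14 r`. [folklore] -/
def ellStar (C Cr c₂ M p₀ β : ℝ) (r n₀ : ℕ) : ℝ :=
  max (ellLog Cr c₂ p₀ (A14 r) M kappaStar r n₀) (ellSmall β C kappaPrimeStar kappa0Star r1Star)

/-- `0 < λ ≤ exp(−ℓ) ⟹ ℓ ≤ −log λ`. [folklore] -/
theorem le_neg_log_of_le_exp_neg {lam ℓ : ℝ} (hlam : 0 < lam) (h : lam ≤ Real.exp (-ℓ)) : ℓ ≤ -Real.log lam := by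
  have := Real.log_le_log hlam h
  rw [Real.log_exp] at this
  linarith

/-- **THE PARAMETER REGIME OF `RegionVolume.stability_of_regions`, EXPLICITLY** — the quantitative form of
`regime_nonempty`: for every `L` with `log L ≥ 1`, all constants `C, Cr ≥ 0`, `c₂ > 0`, `M ≥ 0`, every `n₀ ≥ 4`, `β > 0`
and exponents with `3r + 2 < 2p₀`, the explicit rates `κ₀⋆, κ′⋆, κ⋆, r₁⋆` satisfy the six rate conditions, and for EVERY
`λ` with `0 < λ ≤ λ₀ := exp(−ℓ⋆)`, `ℓ⋆ = ellStar C Cr c₂ M p₀ β r n₀` (a closed-form maximum of two absolute, four power-type and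
three logarithmic thresholds in the data), `LargeLog Cr c₂ p₀ (A14 r) M κ⋆ λ r n₀ L` and the three `λ^{β/2}`-smallness
conditions hold; with `hM_of_le` for the `M`-clause this writes out *"let M be sufficiently large (depending on L), and let
λ_k be sufficiently small (depending on L, M)"* ([Dimock2013BalabanIII] Theorem 1, TeX L265–270) for the kernel end chain.
The constants inside (`A14 r`, `K₀(32,6)`, `K₁(3)`, `κ₀(32,6)`, `κ₁(3)`) are the cell's explicit, unoptimised ones.
[cite: Dimock2013BalabanIII, Theorem 1 (arXiv:1304.0705v1 TeX L265–270)] -/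
theorem regime_explicit {L : ℕ} (hL : 1 ≤ Real.log L) {C Cr c₂ M p₀ β : ℝ} {r n₀ : ℕ}
    (hC : 0 ≤ C) (hCr : 0 ≤ Cr) (hc₂ : 0 < c₂) (hM : 0 ≤ M) (hn₀ : 4 ≤ n₀) (hβ : 0 < β)
    (hexp : (3 * r + 2 : ℝ) < 2 * p₀) :
    (kappaPrimeStar ≤ kappaStar - 1 ∧ kappa₀ 32 6 ≤ kappa0Star ∧ kappa₁ 3 ≤ kappa0Star ∧
        kappa0Star ≤ kappaPrimeStar ∧ kappa₀ 32 6 ≤ r1Star ∧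
        r1Star + 2 * kappa₀ 32 6 + 2 ≤ kappaPrimeStar - kappa0Star - 1 ∧ 0 ≤ C) ∧
      ∀ lam : ℝ, 0 < lam → lam ≤ Real.exp (-ellStar C Cr c₂ M p₀ β r n₀) →
        LargeLog Cr c₂ p₀ (A14 r) M kappaStar lam r n₀ L ∧
        lam ^ (β / 2) * Real.exp (2 * (kappaPrimeStar - kappa0Star)) ≤ 1 ∧
        32 * (K₀ 32 6 + C * K₀ 32 6 + C * K₁ 3) * lam ^ (β / 2) ≤ 1 ∧
        Real.exp (1 / 4) * lam ^ (β / 2) * Real.exp (5 * r1Star + 1) * K₀ 32 6 * 32 ≤ 1 := by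
  obtain ⟨h1, h2, h3, h4, h5, h6, -, hκ⟩ := rates_explicit
  refine ⟨⟨h1, h2, h3, h4, h5, h6, hC⟩, fun lam hlam hle => ?_⟩
  have hℓ := le_neg_log_of_le_exp_neg hlam hle
  have hlog : ellLog Cr c₂ p₀ (A14 r) M kappaStar r n₀ ≤ -Real.log lam := le_trans (le_max_left _ _) hℓ
  have hsm : ellSmall β C kappaPrimeStar kappa0Star r1Star ≤ -Real.log lam := le_trans (le_max_right _ _) hℓ
  exact ⟨largeLog_of_ellLog_le hL hCr hc₂ (A14_pos r) hM hκ hn₀ hexp hlam hlog,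
    smallness_of_ellSmall_le hβ hlam hsm⟩


/-! ## Part 6. (v1.2) The end chain's top statement with every «sufficiently» a number -/

section Explicit

open Literature.MathematicalPhysics.QuantumFieldTheory.Balaban1983to89.TreeLengthTorus (TPt TDom)
open Literature.MathematicalPhysics.QuantumFieldTheory.Dimock2011to13.HistorySum (UnderBound RandallBound)
open Literature.MathematicalPhysics.QuantumFieldTheory.Dimock2011to13.RegionVolume (regionHist vol stability_of_regions)

/-- `log L ≥ 1 ⟹ (L : ℝ) > 0` for a natural `L`. [folklore] -/
theorem cast_pos_of_one_le_log {L : ℕ} (hL : 1 ≤ Real.log L) : 0 < (L : ℝ) := by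
  rcases Nat.eq_zero_or_pos L with h | h
  · subst h; simp at hL; linarith
  · exact_mod_cast h

/-- **COROLLARY 1 OF [Dimock2013BalabanIII] FOR THE KERNEL END CHAIN, WITH EVERY «SUFFICIENTLY LARGE / SMALL» A NUMBER.**
`RegionVolume.stability_of_regions` — (stingray) ∧ (under) ∧ (randall) ⇒ the two-sided stability bound, no geometric or
combinatorial leaf — with its six rate conditions, its `LargeLog` hypothesis, its three `λ^{β/2}`-smallness conditions and
its `M`-clause ALL DISCHARGED by Part 5 at the explicit rates `kappa0Star`/`kappaPrimeStar`/`kappaStar`/`r1Star`: what is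
asked of the parameters is only `log L ≥ 1`, signs of the analytic constants, `n₀ ≥ 4`, `0 < β ≤ n₀`, `3r + 2 < 2p₀`,
`0 < λ ≤ exp(−ellStar C Cr c₂ M p₀ β r n₀)` and `3m·log L ≥ 5/4 + 3κ₀(32,6)`; what is asked of the model is exactly the three
analytic shapes — (stingray) as `ComponentRepresentation`, (under) as `UnderBound … β kappaPrimeStar` (decay at the explicit
rate κ′⋆), (randall) as `RandallBound` over `regionHist` with the actual volumes `vol`.  The print's *"Let L be sufficiently
large, let M be sufficiently large (depending on L), and let λ_k be sufficiently small (depending on L, M)"* (Theorem 1,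
TeX L265–270) and *"let λ be sufficiently small"* (Theorem 2 `major1`, TeX L2452; inherited by Corollary 1 `major2`
(stability), L2491–2497, which states no smallness clause of its own) are thereby written out for the cell's typed chain.
[cite: Dimock2013BalabanIII, Theorem 1 / Theorem 2 / Corollary 1 (arXiv:1304.0705v1 TeX L265–270, L2452–2505)] -/
theorem stability_of_regions_explicit {L m Mv N : ℕ} [NeZero L] [NeZero (L ^ (Mv - m))] {lam ε₀ μ₀ : ℝ}
    {K : TDom 3 (L ^ (Mv - m)) → ℝ} {K' : Finset (TPt 3 (L ^ (Mv - m))) → ℝ}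
    {C Cr c₂ p₀ M β : ℝ} {r n₀ : ℕ} (hm : m ≤ Mv)
    (hrep : ComponentRepresentation L Mv N (L ^ (Mv - m)) lam ε₀ μ₀ K)
    (hund : UnderBound (L ^ (Mv - m)) K K' C lam β kappaPrimeStar)
    (hR : ∀ Θ : Finset (TPt 3 (L ^ (Mv - m))),
      RandallBound (K' Θ) (regionHist L N lam r Θ) (vol lam r M) Cr c₂ p₀ lam)
    (hL : 1 ≤ Real.log L) (hC : 0 ≤ C) (hCr : 0 ≤ Cr) (hc₂ : 0 < c₂) (hM0 : 0 ≤ M) (hn₀ : 4 ≤ n₀)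
    (hβ : 0 < β) (hβn₀ : β ≤ n₀) (hexp : (3 * r + 2 : ℝ) < 2 * p₀)
    (hlam : 0 < lam) (hle : lam ≤ Real.exp (-ellStar C Cr c₂ M p₀ β r n₀))
    (hMm : 5 / 4 + 3 * kappa₀ 32 6 ≤ 3 * m * Real.log L) :
    Real.exp (-(lam ^ (β / 2) * (L : ℝ) ^ (3 * Mv))) ≤ relativePartitionFunction L Mv N 1 lam ε₀ μ₀ ∧
      relativePartitionFunction L Mv N 1 lam ε₀ μ₀ ≤ Real.exp (lam ^ (β / 2) * (L : ℝ) ^ (3 * Mv)) := by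
  obtain ⟨⟨h1, h2, h3, h4, h5, h6, -⟩, hall⟩ := regime_explicit hL hC hCr hc₂ hM0 hn₀ hβ hexp
  obtain ⟨hp, hsmall, htoot, hKP⟩ := hall lam hlam hle
  exact stability_of_regions hm hrep hund hp hR h1 h2 h3 h4 hC hβn₀ hsmall htoot h5 h6 hKP
    (hM_of_le (cast_pos_of_one_le_log hL) hMm)

end Explicit

end Literature.MathematicalPhysics.QuantumFieldTheory.Dimock2011to13.EndChainRegime

end
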